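import Literature.AlgebraicTopology.KTheory.Clutching
import Literature.RingTheory.KTheory.KZeroRing
import HarnessLib

/-!
# Glued idempotents over a closed cover: gluing witnesses, transition functions, recognition

The bookkeeping of the clutching construction `E₁ ∪_g E₂` (Husemöller–Joachim–Jurčo–Schottenloher,
Ch. 3 §7; Husemöller, *Fibre Bundles*, Ch. 10 §7, Ch. 11 Prop. 2.3) in the idempotent model. For
a space `Y = X₁ ∪ X₂` (closed cover, overlap `A = X₁ ∩ X₂`, restrictions `ovl₁`, `ovl₂` to `A`)
and an idempotent matrix `Q` over `C(Y, ℂ)`: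

* `GluingWitness Q P₁ P₂` — normalised local trivialisations `Q|_{Xᵢ} ∼ Pᵢ` (`xᵢ yᵢ = Q|_{Xᵢ}`,
  `yᵢ xᵢ = Pᵢ`); its **transition function** `w.g = y₂ x₁` over `A` (and `w.h = y₁ x₂`, with
  `g h = P₂|_A`, `h g = P₁|_A`);
* **recognition lemma** `GluingWitness.algEquivalent_of_g_eq` — two idempotents with witnesses to
  the same local models and the *same transition function* are algebraically equivalent (a
  bundle is determined by its clutching function, op. cit. (7.4));
* operations: `ofAlgEquivalent` (global equivalences keep `g`), `reframe` (change of local models: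
  `g ↦ d₂ g c₁`), `sum` (`g ⊕ g'`), `kronecker` (`g ⊗ g'`; tensor product of clutchings,
  Husemöller Ch. 10 Prop. 1.5), `tautological` (`Q` is glued from its restrictions with `g = Q|_A`);
* **existence** `exists_gluingWitness` — on a normal space, for `P₁`, `P₂` conjugate over `A` by an
  invertible `u`, the clutching construction of `Clutching.lean` (Whitehead lift) produces `Q`
  *with a witness* of transition `P₂|_A u P₁|_A`.

Everything is proved; no named facts. This is the infrastructure for bundles over `X × S²`
presented by clutching functions on `X × S¹` (Bott periodicity).

## References

* D. Husemöller, M. Joachim, B. Jurčo, M. Schottenloher, *Basic Bundle Theory and K-Cohomology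
  Invariants*, LNP 726 (2008) [HusemollerEtAl2008]: Ch. 3 §7 (7.2) clutching, (7.4) functoriality.
* D. Husemöller, *Fibre Bundles*, 3rd ed. (1994) [HusemollerFibreBundles1994]: Ch. 10 §7 and
  Prop. 1.5 (sums and tensor products of collapsed/clutched bundles), Ch. 11 Prop. 2.3.

## Design notes

* Witnesses are *data* (a structure), so that transition functions can be computed for the
  derived witnesses; the K-theoretic statements only use their existence.
* The normalisation `xᵢ yᵢ xᵢ = xᵢ`, `yᵢ xᵢ yᵢ = yᵢ` is what makes restriction to the overlap
  well behaved (`x₁|_A = x₂|_A g`, `y₂|_A = g y₁|_A`).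
-/

noncomputable section

namespace Literature.AlgebraicTopology.KTheory

open Literature.RingTheory.KTheory Matrix Set Kronecker

universe u

variable {Y : Type u} [TopologicalSpace Y] {X₁ X₂ : Set Y}

variable (X₁ X₂) in
/-- Restriction from the first piece to the overlap `X₁ ∩ X₂`. [folklore] -/
abbrev ovl₁ : C(X₁, ℂ) →+* C(↥(X₁ ∩ X₂), ℂ) := resHomOfSubset inter_subset_left

variable (X₁ X₂) in
/-- Restriction from the second piece to the overlap `X₁ ∩ X₂`. [folklore] -/
abbrev ovl₂ : C(X₂, ℂ) →+* C(↥(X₁ ∩ X₂), ℂ) := resHomOfSubset inter_subset_right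

/-- Restricting from `Y` to the overlap through either piece agrees. [folklore] -/
theorem map_resHom_ovl {m k : Type*} (Q : Matrix m k C(Y, ℂ)) :
    (Q.map (resHom X₁)).map (ovl₁ X₁ X₂) = (Q.map (resHom X₂)).map (ovl₂ X₁ X₂) := by
  rw [Matrix.map_map, Matrix.map_map]
  have h1 := resHomOfSubset_comp_resHom (X := Y) (inter_subset_left : X₁ ∩ X₂ ⊆ X₁)
  have h2 := resHomOfSubset_comp_resHom (X := Y) (inter_subset_right : X₁ ∩ X₂ ⊆ X₂)
  have e : ∀ φ ψ : C(Y, ℂ) →+* C(↥(X₁ ∩ X₂), ℂ), φ = ψ → Q.map φ = Q.map ψ := fun _ _ h ↦ by rw [h]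
  simpa only [RingHom.coe_comp] using e _ _ (h1.trans h2.symm)

/-- Entrywise ring homomorphisms commute with Kronecker products. [folklore] -/
theorem kronecker_map_ringHom {R S : Type*} [CommRing R] [CommRing S] (f : R →+* S) {a b c d : Type*}
    (A : Matrix a b R) (B : Matrix c d R) : (A ⊗ₖ B).map f = A.map f ⊗ₖ B.map f := by
  ext ⟨i, j⟩ ⟨i', j'⟩; simp

/-- **Gluing witness**: local trivialisations of an idempotent matrix `Q` over `Y = X₁ ∪ X₂` — normalised
algebraic equivalences `Q|_{X₁} ∼ P₁`, `Q|_{X₂} ∼ P₂` (`xᵢ yᵢ = Q|_{Xᵢ}`, `yᵢ xᵢ = Pᵢ`). The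
*transition function* of the witness is `g = y₂ x₁` over `A = X₁ ∩ X₂` (`GluingWitness.g`), the
matrix form of the clutching function of a bundle presented as `E₁ ∪_g E₂` (Husemöller et al.,
Ch. 3 §7; Husemöller, *Fibre Bundles*, Ch. 11 Prop. 2.3). [cite: HusemollerEtAl2008, Ch. 3 §7 (7.2)] -/
structure GluingWitness {m n₁ n₂ : Type*} [Fintype m] [Fintype n₁] [Fintype n₂]
    (Q : Matrix m m C(Y, ℂ)) (P₁ : Matrix n₁ n₁ C(X₁, ℂ)) (P₂ : Matrix n₂ n₂ C(X₂, ℂ)) where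
  /-- `x₁ : P₁ → Q|_{X₁}` -/
  x₁ : Matrix m n₁ C(X₁, ℂ)
  /-- `y₁ : Q|_{X₁} → P₁` -/
  y₁ : Matrix n₁ m C(X₁, ℂ)
  /-- `x₂ : P₂ → Q|_{X₂}` -/
  x₂ : Matrix m n₂ C(X₂, ℂ)
  /-- `y₂ : Q|_{X₂} → P₂` -/
  y₂ : Matrix n₂ m C(X₂, ℂ)
  hxy₁ : x₁ * y₁ = Q.map (resHom X₁)
  hyx₁ : y₁ * x₁ = P₁
  hx₁ : x₁ * y₁ * x₁ = x₁
  hy₁ : y₁ * x₁ * y₁ = y₁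
  hxy₂ : x₂ * y₂ = Q.map (resHom X₂)
  hyx₂ : y₂ * x₂ = P₂
  hx₂ : x₂ * y₂ * x₂ = x₂
  hy₂ : y₂ * x₂ * y₂ = y₂

namespace GluingWitness

variable {m n₁ n₂ : Type*} [Fintype m] [Fintype n₁] [Fintype n₂]
variable {Q : Matrix m m C(Y, ℂ)} {P₁ : Matrix n₁ n₁ C(X₁, ℂ)} {P₂ : Matrix n₂ n₂ C(X₂, ℂ)}

/-- The transition function `g = y₂ x₁ : P₁|_A → P₂|_A` over `A = X₁ ∩ X₂`. [cite: HusemollerEtAl2008, Ch. 3 §7 (7.2)] -/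
def g (w : GluingWitness Q P₁ P₂) : Matrix n₂ n₁ C(↥(X₁ ∩ X₂), ℂ) :=
  w.y₂.map (ovl₂ X₁ X₂) * w.x₁.map (ovl₁ X₁ X₂)

/-- The reverse transition `h = y₁ x₂ : P₂|_A → P₁|_A`. [cite: HusemollerEtAl2008, Ch. 3 §7 (7.2)] -/
def h (w : GluingWitness Q P₁ P₂) : Matrix n₁ n₂ C(↥(X₁ ∩ X₂), ℂ) :=
  w.y₁.map (ovl₁ X₁ X₂) * w.x₂.map (ovl₂ X₁ X₂)

/-- Auxiliary identity for gluing witnesses. [folklore] -/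
theorem algEquivalent₁ (w : GluingWitness Q P₁ P₂) : AlgEquivalent (Q.map (resHom X₁)) P₁ :=
  ⟨w.x₁, w.y₁, w.hxy₁, w.hyx₁, w.hx₁, w.hy₁⟩

/-- Auxiliary identity for gluing witnesses. [folklore] -/
theorem algEquivalent₂ (w : GluingWitness Q P₁ P₂) : AlgEquivalent (Q.map (resHom X₂)) P₂ :=
  ⟨w.x₂, w.y₂, w.hxy₂, w.hyx₂, w.hx₂, w.hy₂⟩

/-- Auxiliary identity for gluing witnesses. [folklore] -/
theorem isIdempotentElem₁ (w : GluingWitness Q P₁ P₂) : IsIdempotentElem P₁ := w.algEquivalent₁.isIdempotentElem_right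
/-- Auxiliary identity for gluing witnesses. [folklore] -/
theorem isIdempotentElem₂ (w : GluingWitness Q P₁ P₂) : IsIdempotentElem P₂ := w.algEquivalent₂.isIdempotentElem_right

/-- `g h = P₂|_A`. [cite: HusemollerEtAl2008, Ch. 3 §7 (7.2)] -/
theorem g_mul_h (w : GluingWitness Q P₁ P₂) : w.g * w.h = P₂.map (ovl₂ X₁ X₂) := by
  have e1 : w.x₁.map (ovl₁ X₁ X₂) * w.y₁.map (ovl₁ X₁ X₂) = (Q.map (resHom X₂)).map (ovl₂ X₁ X₂) := by
    rw [← Matrix.map_mul, w.hxy₁, map_resHom_ovl]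
  calc w.g * w.h = w.y₂.map (ovl₂ X₁ X₂) * (w.x₁.map (ovl₁ X₁ X₂) * w.y₁.map (ovl₁ X₁ X₂)) * w.x₂.map (ovl₂ X₁ X₂) := by
        simp only [g, h, Matrix.mul_assoc]
    _ = (w.y₂ * (Q.map (resHom X₂)) * w.x₂).map (ovl₂ X₁ X₂) := by rw [e1, Matrix.map_mul, Matrix.map_mul]
    _ = P₂.map (ovl₂ X₁ X₂) := by rw [← w.hxy₂, ← Matrix.mul_assoc, w.hy₂, w.hyx₂]

/-- `h g = P₁|_A`. [cite: HusemollerEtAl2008, Ch. 3 §7 (7.2)] -/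
theorem h_mul_g (w : GluingWitness Q P₁ P₂) : w.h * w.g = P₁.map (ovl₁ X₁ X₂) := by
  have e2 : w.x₂.map (ovl₂ X₁ X₂) * w.y₂.map (ovl₂ X₁ X₂) = (Q.map (resHom X₁)).map (ovl₁ X₁ X₂) := by
    rw [← Matrix.map_mul, w.hxy₂, ← map_resHom_ovl]
  calc w.h * w.g = w.y₁.map (ovl₁ X₁ X₂) * (w.x₂.map (ovl₂ X₁ X₂) * w.y₂.map (ovl₂ X₁ X₂)) * w.x₁.map (ovl₁ X₁ X₂) := by
        simp only [g, h, Matrix.mul_assoc]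
    _ = (w.y₁ * (Q.map (resHom X₁)) * w.x₁).map (ovl₁ X₁ X₂) := by rw [e2, Matrix.map_mul, Matrix.map_mul]
    _ = P₁.map (ovl₁ X₁ X₂) := by rw [← w.hxy₁, ← Matrix.mul_assoc, w.hy₁, w.hyx₁]

/-! Normalisation consequences. -/

/-- Auxiliary identity for gluing witnesses. [folklore] -/
theorem restrict₁_mul_x₁ (w : GluingWitness Q P₁ P₂) : Q.map (resHom X₁) * w.x₁ = w.x₁ := by
  rw [← w.hxy₁, w.hx₁]

/-- Auxiliary identity for gluing witnesses. [folklore] -/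
theorem y₁_mul_restrict₁ (w : GluingWitness Q P₁ P₂) : w.y₁ * Q.map (resHom X₁) = w.y₁ := by
  rw [← w.hxy₁, ← Matrix.mul_assoc, w.hy₁]

/-- Auxiliary identity for gluing witnesses. [folklore] -/
theorem restrict₂_mul_x₂ (w : GluingWitness Q P₁ P₂) : Q.map (resHom X₂) * w.x₂ = w.x₂ := by
  rw [← w.hxy₂, w.hx₂]

/-- Auxiliary identity for gluing witnesses. [folklore] -/
theorem y₂_mul_restrict₂ (w : GluingWitness Q P₁ P₂) : w.y₂ * Q.map (resHom X₂) = w.y₂ := by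
  rw [← w.hxy₂, ← Matrix.mul_assoc, w.hy₂]

/-- Auxiliary identity for gluing witnesses. [folklore] -/
theorem x₁_mul_P₁ (w : GluingWitness Q P₁ P₂) : w.x₁ * P₁ = w.x₁ := by
  calc w.x₁ * P₁ = w.x₁ * (w.y₁ * w.x₁) := by rw [w.hyx₁]
    _ = w.x₁ := by rw [← Matrix.mul_assoc, w.hx₁]

/-- Auxiliary identity for gluing witnesses. [folklore] -/
theorem P₁_mul_y₁ (w : GluingWitness Q P₁ P₂) : P₁ * w.y₁ = w.y₁ := by
  calc P₁ * w.y₁ = w.y₁ * w.x₁ * w.y₁ := by rw [w.hyx₁]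
    _ = w.y₁ := w.hy₁

/-- Auxiliary identity for gluing witnesses. [folklore] -/
theorem x₂_mul_P₂ (w : GluingWitness Q P₁ P₂) : w.x₂ * P₂ = w.x₂ := by
  calc w.x₂ * P₂ = w.x₂ * (w.y₂ * w.x₂) := by rw [w.hyx₂]
    _ = w.x₂ := by rw [← Matrix.mul_assoc, w.hx₂]

/-- Auxiliary identity for gluing witnesses. [folklore] -/
theorem P₂_mul_y₂ (w : GluingWitness Q P₁ P₂) : P₂ * w.y₂ = w.y₂ := by
  calc P₂ * w.y₂ = w.y₂ * w.x₂ * w.y₂ := by rw [w.hyx₂]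
    _ = w.y₂ := w.hy₂

/-- `x₁|_A = x₂|_A g`. [folklore] -/
theorem x₁_ovl (w : GluingWitness Q P₁ P₂) : w.x₁.map (ovl₁ X₁ X₂) = w.x₂.map (ovl₂ X₁ X₂) * w.g := by
  rw [g, ← Matrix.mul_assoc, ← Matrix.map_mul, w.hxy₂, ← map_resHom_ovl, ← Matrix.map_mul, w.restrict₁_mul_x₁]

/-- `y₂|_A = g y₁|_A`. [folklore] -/
theorem y₂_ovl (w : GluingWitness Q P₁ P₂) : w.y₂.map (ovl₂ X₁ X₂) = w.g * w.y₁.map (ovl₁ X₁ X₂) := by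
  rw [g, Matrix.mul_assoc, ← Matrix.map_mul, w.hxy₁, map_resHom_ovl, ← Matrix.map_mul, w.y₂_mul_restrict₂]

/-- The glued matrix is idempotent (its restrictions are). [folklore] -/
theorem isIdempotentElem (hcov : X₁ ∪ X₂ = univ) (w : GluingWitness Q P₁ P₂) : IsIdempotentElem Q :=
  matrix_eq_of_restrict_eq hcov (by rw [Matrix.map_mul, w.algEquivalent₁.isIdempotentElem_left.eq])
    (by rw [Matrix.map_mul, w.algEquivalent₂.isIdempotentElem_left.eq])

/-- **Recognition lemma**: two idempotents over `Y = X₁ ∪ X₂` admitting gluing witnesses with the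
*same* local models `P₁, P₂` and the *same* transition function are algebraically equivalent
("a bundle is determined up to isomorphism by its clutching function", Husemöller et al., Ch. 3
§7 (7.4); Husemöller, *Fibre Bundles*, Ch. 11 Prop. 2.3, uniqueness). The equivalence is glued
from `aᵢ = xᵢ yᵢ'`, `bᵢ = xᵢ' yᵢ`, which agree on `A` exactly when the transitions do.
[cite: HusemollerEtAl2008, Ch. 3 §7 (7.4)] -/
theorem algEquivalent_of_g_eq (h₁ : IsClosed X₁) (h₂ : IsClosed X₂) (hcov : X₁ ∪ X₂ = univ)
    {m' : Type*} [Fintype m'] {Q' : Matrix m' m' C(Y, ℂ)}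
    (w : GluingWitness Q P₁ P₂) (w' : GluingWitness Q' P₁ P₂) (hg : w.g = w'.g) : AlgEquivalent Q Q' := by
  refine algEquivalent_of_cover h₁ h₂ hcov (w.isIdempotentElem hcov) (w'.isIdempotentElem hcov)
    (w.x₁ * w'.y₁) (w'.x₁ * w.y₁) (w.x₂ * w'.y₂) (w'.x₂ * w.y₂) ?_ ?_ ?_ ?_ ?_ ?_
  · rw [Matrix.mul_assoc, ← Matrix.mul_assoc w'.y₁, w'.hyx₁, ← Matrix.mul_assoc, w.x₁_mul_P₁, w.hxy₁]
  · rw [Matrix.mul_assoc, ← Matrix.mul_assoc w.y₁, w.hyx₁, ← Matrix.mul_assoc, w'.x₁_mul_P₁, w'.hxy₁]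
  · rw [Matrix.mul_assoc, ← Matrix.mul_assoc w'.y₂, w'.hyx₂, ← Matrix.mul_assoc, w.x₂_mul_P₂, w.hxy₂]
  · rw [Matrix.mul_assoc, ← Matrix.mul_assoc w.y₂, w.hyx₂, ← Matrix.mul_assoc, w'.x₂_mul_P₂, w'.hxy₂]
  · rw [Matrix.map_mul, Matrix.map_mul, w.x₁_ovl, w'.y₂_ovl, hg, Matrix.mul_assoc]
  · rw [Matrix.map_mul, Matrix.map_mul, w'.x₁_ovl, w.y₂_ovl, hg, Matrix.mul_assoc]

/-! ### Operations on gluing witnesses -/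

/-- Transport a gluing witness along a global algebraic equivalence `Q' ∼ Q`; the transition
function is unchanged (`g_ofAlgEquivalent`). [cite: HusemollerEtAl2008, Ch. 3 §7 (7.4)] -/
def ofAlgEquivalent {m' : Type*} [Fintype m'] {Q' : Matrix m' m' C(Y, ℂ)} (w : GluingWitness Q P₁ P₂)
    (c : Matrix m' m C(Y, ℂ)) (d : Matrix m m' C(Y, ℂ)) (hcd : c * d = Q') (hdc : d * c = Q)
    (hc : c * d * c = c) : GluingWitness Q' P₁ P₂ where
  x₁ := c.map (resHom X₁) * w.x₁
  y₁ := w.y₁ * d.map (resHom X₁)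
  x₂ := c.map (resHom X₂) * w.x₂
  y₂ := w.y₂ * d.map (resHom X₂)
  hxy₁ := by
    calc c.map (resHom X₁) * w.x₁ * (w.y₁ * d.map (resHom X₁))
        = c.map (resHom X₁) * (w.x₁ * w.y₁) * d.map (resHom X₁) := by simp only [Matrix.mul_assoc]
      _ = (c * (d * c) * d).map (resHom X₁) := by rw [w.hxy₁, hdc, Matrix.map_mul, Matrix.map_mul]
      _ = Q'.map (resHom X₁) := by rw [← Matrix.mul_assoc, hc, hcd]
  hyx₁ := by
    calc w.y₁ * d.map (resHom X₁) * (c.map (resHom X₁) * w.x₁)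
        = w.y₁ * ((d * c).map (resHom X₁)) * w.x₁ := by rw [Matrix.map_mul]; simp only [Matrix.mul_assoc]
      _ = P₁ := by rw [hdc, w.y₁_mul_restrict₁, w.hyx₁]
  hx₁ := by
    calc c.map (resHom X₁) * w.x₁ * (w.y₁ * d.map (resHom X₁)) * (c.map (resHom X₁) * w.x₁)
        = c.map (resHom X₁) * (w.x₁ * w.y₁) * ((d * c).map (resHom X₁)) * w.x₁ := by
          rw [Matrix.map_mul]; simp only [Matrix.mul_assoc]
      _ = c.map (resHom X₁) * w.x₁ := by
          rw [w.hxy₁, hdc]; simp only [Matrix.mul_assoc, w.restrict₁_mul_x₁]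
  hy₁ := by
    calc w.y₁ * d.map (resHom X₁) * (c.map (resHom X₁) * w.x₁) * (w.y₁ * d.map (resHom X₁))
        = w.y₁ * ((d * c).map (resHom X₁)) * w.x₁ * w.y₁ * d.map (resHom X₁) := by
          rw [Matrix.map_mul]; simp only [Matrix.mul_assoc]
      _ = w.y₁ * d.map (resHom X₁) := by rw [hdc, w.y₁_mul_restrict₁, w.hy₁]
  hxy₂ := by
    calc c.map (resHom X₂) * w.x₂ * (w.y₂ * d.map (resHom X₂))
        = c.map (resHom X₂) * (w.x₂ * w.y₂) * d.map (resHom X₂) := by simp only [Matrix.mul_assoc]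
      _ = (c * (d * c) * d).map (resHom X₂) := by rw [w.hxy₂, hdc, Matrix.map_mul, Matrix.map_mul]
      _ = Q'.map (resHom X₂) := by rw [← Matrix.mul_assoc, hc, hcd]
  hyx₂ := by
    calc w.y₂ * d.map (resHom X₂) * (c.map (resHom X₂) * w.x₂)
        = w.y₂ * ((d * c).map (resHom X₂)) * w.x₂ := by rw [Matrix.map_mul]; simp only [Matrix.mul_assoc]
      _ = P₂ := by rw [hdc, w.y₂_mul_restrict₂, w.hyx₂]
  hx₂ := by
    calc c.map (resHom X₂) * w.x₂ * (w.y₂ * d.map (resHom X₂)) * (c.map (resHom X₂) * w.x₂)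
        = c.map (resHom X₂) * (w.x₂ * w.y₂) * ((d * c).map (resHom X₂)) * w.x₂ := by
          rw [Matrix.map_mul]; simp only [Matrix.mul_assoc]
      _ = c.map (resHom X₂) * w.x₂ := by
          rw [w.hxy₂, hdc]; simp only [Matrix.mul_assoc, w.restrict₂_mul_x₂]
  hy₂ := by
    calc w.y₂ * d.map (resHom X₂) * (c.map (resHom X₂) * w.x₂) * (w.y₂ * d.map (resHom X₂))
        = w.y₂ * ((d * c).map (resHom X₂)) * w.x₂ * w.y₂ * d.map (resHom X₂) := by
          rw [Matrix.map_mul]; simp only [Matrix.mul_assoc]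
      _ = w.y₂ * d.map (resHom X₂) := by rw [hdc, w.y₂_mul_restrict₂, w.hy₂]

/-- A global equivalence does not change the transition function. [cite: HusemollerEtAl2008, Ch. 3 §7 (7.4)] -/
theorem g_ofAlgEquivalent {m' : Type*} [Fintype m'] {Q' : Matrix m' m' C(Y, ℂ)} (w : GluingWitness Q P₁ P₂)
    (c : Matrix m' m C(Y, ℂ)) (d : Matrix m m' C(Y, ℂ)) (hcd : c * d = Q') (hdc : d * c = Q)
    (hc : c * d * c = c) : (w.ofAlgEquivalent c d hcd hdc hc).g = w.g := by
  change (w.y₂ * d.map (resHom X₂)).map (ovl₂ X₁ X₂) * (c.map (resHom X₁) * w.x₁).map (ovl₁ X₁ X₂) =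
    w.y₂.map (ovl₂ X₁ X₂) * w.x₁.map (ovl₁ X₁ X₂)
  have key : (d.map (resHom X₁)).map (ovl₁ X₁ X₂) * (c.map (resHom X₁) * w.x₁).map (ovl₁ X₁ X₂) =
      w.x₁.map (ovl₁ X₁ X₂) := by
    rw [← Matrix.map_mul, ← Matrix.mul_assoc, ← Matrix.map_mul, hdc, w.restrict₁_mul_x₁]
  rw [Matrix.map_mul (L := w.y₂) (M := d.map (resHom X₂)), ← map_resHom_ovl d, Matrix.mul_assoc, key]

/-- **Change of local models**: composing with equivalences `Pᵢ ∼ Pᵢ'` (normalised witnesses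
`cᵢ dᵢ = Pᵢ`, `dᵢ cᵢ = Pᵢ'`) gives a witness with models `Pᵢ'` and transition `d₂ g c₁`.
[cite: HusemollerEtAl2008, Ch. 3 §7 (7.4)] -/
def reframe {n₁' n₂' : Type*} [Fintype n₁'] [Fintype n₂'] {P₁' : Matrix n₁' n₁' C(X₁, ℂ)} {P₂' : Matrix n₂' n₂' C(X₂, ℂ)}
    (w : GluingWitness Q P₁ P₂)
    (c₁ : Matrix n₁ n₁' C(X₁, ℂ)) (d₁ : Matrix n₁' n₁ C(X₁, ℂ)) (hcd₁ : c₁ * d₁ = P₁) (hdc₁ : d₁ * c₁ = P₁')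
    (hd₁ : d₁ * c₁ * d₁ = d₁)
    (c₂ : Matrix n₂ n₂' C(X₂, ℂ)) (d₂ : Matrix n₂' n₂ C(X₂, ℂ)) (hcd₂ : c₂ * d₂ = P₂) (hdc₂ : d₂ * c₂ = P₂')
    (hd₂ : d₂ * c₂ * d₂ = d₂) : GluingWitness Q P₁' P₂' where
  x₁ := w.x₁ * c₁
  y₁ := d₁ * w.y₁
  x₂ := w.x₂ * c₂
  y₂ := d₂ * w.y₂
  hxy₁ := by
    calc w.x₁ * c₁ * (d₁ * w.y₁) = w.x₁ * (c₁ * d₁) * w.y₁ := by simp only [Matrix.mul_assoc]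
      _ = _ := by rw [hcd₁, w.x₁_mul_P₁, w.hxy₁]
  hyx₁ := by
    calc d₁ * w.y₁ * (w.x₁ * c₁) = d₁ * (w.y₁ * w.x₁) * c₁ := by simp only [Matrix.mul_assoc]
      _ = P₁' := by rw [w.hyx₁, ← hcd₁, ← Matrix.mul_assoc, hd₁, hdc₁]
  hx₁ := by
    calc w.x₁ * c₁ * (d₁ * w.y₁) * (w.x₁ * c₁) = w.x₁ * (c₁ * d₁) * w.y₁ * w.x₁ * c₁ := by simp only [Matrix.mul_assoc]
      _ = w.x₁ * c₁ := by rw [hcd₁, w.x₁_mul_P₁, w.hx₁]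
  hy₁ := by
    calc d₁ * w.y₁ * (w.x₁ * c₁) * (d₁ * w.y₁) = d₁ * (w.y₁ * w.x₁) * (c₁ * d₁) * w.y₁ := by simp only [Matrix.mul_assoc]
      _ = d₁ * w.y₁ := by rw [w.hyx₁, hcd₁, Matrix.mul_assoc d₁ P₁ P₁, w.isIdempotentElem₁.eq, Matrix.mul_assoc, w.P₁_mul_y₁]
  hxy₂ := by
    calc w.x₂ * c₂ * (d₂ * w.y₂) = w.x₂ * (c₂ * d₂) * w.y₂ := by simp only [Matrix.mul_assoc]
      _ = _ := by rw [hcd₂, w.x₂_mul_P₂, w.hxy₂]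
  hyx₂ := by
    calc d₂ * w.y₂ * (w.x₂ * c₂) = d₂ * (w.y₂ * w.x₂) * c₂ := by simp only [Matrix.mul_assoc]
      _ = P₂' := by rw [w.hyx₂, ← hcd₂, ← Matrix.mul_assoc, hd₂, hdc₂]
  hx₂ := by
    calc w.x₂ * c₂ * (d₂ * w.y₂) * (w.x₂ * c₂) = w.x₂ * (c₂ * d₂) * w.y₂ * w.x₂ * c₂ := by simp only [Matrix.mul_assoc]
      _ = w.x₂ * c₂ := by rw [hcd₂, w.x₂_mul_P₂, w.hx₂]
  hy₂ := by
    calc d₂ * w.y₂ * (w.x₂ * c₂) * (d₂ * w.y₂) = d₂ * (w.y₂ * w.x₂) * (c₂ * d₂) * w.y₂ := by simp only [Matrix.mul_assoc]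
      _ = d₂ * w.y₂ := by rw [w.hyx₂, hcd₂, Matrix.mul_assoc d₂ P₂ P₂, w.isIdempotentElem₂.eq, Matrix.mul_assoc, w.P₂_mul_y₂]

/-- The transition after a change of local models is `d₂|_A g c₁|_A`. [cite: HusemollerEtAl2008, Ch. 3 §7 (7.4)] -/
theorem g_reframe {n₁' n₂' : Type*} [Fintype n₁'] [Fintype n₂'] {P₁' : Matrix n₁' n₁' C(X₁, ℂ)}
    {P₂' : Matrix n₂' n₂' C(X₂, ℂ)} (w : GluingWitness Q P₁ P₂)
    (c₁ : Matrix n₁ n₁' C(X₁, ℂ)) (d₁ : Matrix n₁' n₁ C(X₁, ℂ)) (hcd₁ hdc₁ hd₁)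
    (c₂ : Matrix n₂ n₂' C(X₂, ℂ)) (d₂ : Matrix n₂' n₂ C(X₂, ℂ)) (hcd₂ hdc₂ hd₂) :
    (w.reframe c₁ d₁ hcd₁ hdc₁ hd₁ c₂ d₂ hcd₂ hdc₂ hd₂ : GluingWitness Q P₁' P₂').g =
      d₂.map (ovl₂ X₁ X₂) * w.g * c₁.map (ovl₁ X₁ X₂) := by
  change (d₂ * w.y₂).map (ovl₂ X₁ X₂) * (w.x₁ * c₁).map (ovl₁ X₁ X₂) = _
  rw [Matrix.map_mul, Matrix.map_mul, g]; simp only [Matrix.mul_assoc]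

/-- **Direct sum** of gluing witnesses (block diagonal); transition `g ⊕ g'`.
[cite: HusemollerEtAl2008, Ch. 3 §7 (7.4)] -/
def sum {m' n₁' n₂' : Type*} [Fintype m'] [Fintype n₁'] [Fintype n₂'] {Q' : Matrix m' m' C(Y, ℂ)}
    {P₁' : Matrix n₁' n₁' C(X₁, ℂ)} {P₂' : Matrix n₂' n₂' C(X₂, ℂ)}
    (w : GluingWitness Q P₁ P₂) (w' : GluingWitness Q' P₁' P₂') :
    GluingWitness (Matrix.fromBlocks Q 0 0 Q') (Matrix.fromBlocks P₁ 0 0 P₁') (Matrix.fromBlocks P₂ 0 0 P₂') where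
  x₁ := Matrix.fromBlocks w.x₁ 0 0 w'.x₁
  y₁ := Matrix.fromBlocks w.y₁ 0 0 w'.y₁
  x₂ := Matrix.fromBlocks w.x₂ 0 0 w'.x₂
  y₂ := Matrix.fromBlocks w.y₂ 0 0 w'.y₂
  hxy₁ := by rw [Matrix.fromBlocks_multiply, Matrix.fromBlocks_map]; simp [w.hxy₁, w'.hxy₁]
  hyx₁ := by rw [Matrix.fromBlocks_multiply]; simp [w.hyx₁, w'.hyx₁]
  hx₁ := by rw [Matrix.fromBlocks_multiply, Matrix.fromBlocks_multiply]; simp [w.hx₁, w'.hx₁]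
  hy₁ := by rw [Matrix.fromBlocks_multiply, Matrix.fromBlocks_multiply]; simp [w.hy₁, w'.hy₁]
  hxy₂ := by rw [Matrix.fromBlocks_multiply, Matrix.fromBlocks_map]; simp [w.hxy₂, w'.hxy₂]
  hyx₂ := by rw [Matrix.fromBlocks_multiply]; simp [w.hyx₂, w'.hyx₂]
  hx₂ := by rw [Matrix.fromBlocks_multiply, Matrix.fromBlocks_multiply]; simp [w.hx₂, w'.hx₂]
  hy₂ := by rw [Matrix.fromBlocks_multiply, Matrix.fromBlocks_multiply]; simp [w.hy₂, w'.hy₂]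

/-- Auxiliary identity for gluing witnesses. [folklore] -/
theorem g_sum {m' n₁' n₂' : Type*} [Fintype m'] [Fintype n₁'] [Fintype n₂'] {Q' : Matrix m' m' C(Y, ℂ)}
    {P₁' : Matrix n₁' n₁' C(X₁, ℂ)} {P₂' : Matrix n₂' n₂' C(X₂, ℂ)}
    (w : GluingWitness Q P₁ P₂) (w' : GluingWitness Q' P₁' P₂') :
    (w.sum w').g = Matrix.fromBlocks w.g 0 0 w'.g := by
  change (Matrix.fromBlocks w.y₂ 0 0 w'.y₂).map (ovl₂ X₁ X₂) * (Matrix.fromBlocks w.x₁ 0 0 w'.x₁).map (ovl₁ X₁ X₂) = _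
  rw [Matrix.fromBlocks_map, Matrix.fromBlocks_map, Matrix.fromBlocks_multiply]
  simp [g, Matrix.map_zero _ (map_zero _)]

/-- **Tensor product** of gluing witnesses (Kronecker); transition `g ⊗ g'` (Husemöller et al.,
Ch. 3 §7 (7.4); Husemöller, *Fibre Bundles*, Ch. 10 Prop. 1.5: tensor products of clutchings).
[cite: HusemollerEtAl2008, Ch. 3 §7 (7.4)] -/
def kronecker {m' n₁' n₂' : Type*} [Fintype m'] [Fintype n₁'] [Fintype n₂'] {Q' : Matrix m' m' C(Y, ℂ)}
    {P₁' : Matrix n₁' n₁' C(X₁, ℂ)} {P₂' : Matrix n₂' n₂' C(X₂, ℂ)}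
    (w : GluingWitness Q P₁ P₂) (w' : GluingWitness Q' P₁' P₂') :
    GluingWitness (Q ⊗ₖ Q') (P₁ ⊗ₖ P₁') (P₂ ⊗ₖ P₂') where
  x₁ := w.x₁ ⊗ₖ w'.x₁
  y₁ := w.y₁ ⊗ₖ w'.y₁
  x₂ := w.x₂ ⊗ₖ w'.x₂
  y₂ := w.y₂ ⊗ₖ w'.y₂
  hxy₁ := by rw [← Matrix.mul_kronecker_mul, w.hxy₁, w'.hxy₁, kronecker_map_ringHom]
  hyx₁ := by rw [← Matrix.mul_kronecker_mul, w.hyx₁, w'.hyx₁]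
  hx₁ := by rw [← Matrix.mul_kronecker_mul, ← Matrix.mul_kronecker_mul, w.hx₁, w'.hx₁]
  hy₁ := by rw [← Matrix.mul_kronecker_mul, ← Matrix.mul_kronecker_mul, w.hy₁, w'.hy₁]
  hxy₂ := by rw [← Matrix.mul_kronecker_mul, w.hxy₂, w'.hxy₂, kronecker_map_ringHom]
  hyx₂ := by rw [← Matrix.mul_kronecker_mul, w.hyx₂, w'.hyx₂]
  hx₂ := by rw [← Matrix.mul_kronecker_mul, ← Matrix.mul_kronecker_mul, w.hx₂, w'.hx₂]
  hy₂ := by rw [← Matrix.mul_kronecker_mul, ← Matrix.mul_kronecker_mul, w.hy₂, w'.hy₂]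

/-- Auxiliary identity for gluing witnesses. [folklore] -/
theorem g_kronecker {m' n₁' n₂' : Type*} [Fintype m'] [Fintype n₁'] [Fintype n₂'] {Q' : Matrix m' m' C(Y, ℂ)}
    {P₁' : Matrix n₁' n₁' C(X₁, ℂ)} {P₂' : Matrix n₂' n₂' C(X₂, ℂ)}
    (w : GluingWitness Q P₁ P₂) (w' : GluingWitness Q' P₁' P₂') : (w.kronecker w').g = w.g ⊗ₖ w'.g := by
  change (w.y₂ ⊗ₖ w'.y₂).map (ovl₂ X₁ X₂) * (w.x₁ ⊗ₖ w'.x₁).map (ovl₁ X₁ X₂) = _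
  rw [g, g, Matrix.mul_kronecker_mul, kronecker_map_ringHom, kronecker_map_ringHom]

/-- **Tautological witness**: an idempotent is glued from its own restrictions with transition
`Q|_A`. [folklore] -/
def tautological (hQ : IsIdempotentElem Q) : GluingWitness Q (Q.map (resHom X₁)) (Q.map (resHom X₂)) :=
  have h₁ : IsIdempotentElem (Q.map (resHom X₁)) := by rw [IsIdempotentElem, ← Matrix.map_mul, hQ.eq]
  have h₂ : IsIdempotentElem (Q.map (resHom X₂)) := by rw [IsIdempotentElem, ← Matrix.map_mul, hQ.eq]
  { x₁ := Q.map (resHom X₁), y₁ := Q.map (resHom X₁), x₂ := Q.map (resHom X₂), y₂ := Q.map (resHom X₂),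
    hxy₁ := h₁.eq, hyx₁ := h₁.eq, hx₁ := by rw [h₁.eq, h₁.eq], hy₁ := by rw [h₁.eq, h₁.eq],
    hxy₂ := h₂.eq, hyx₂ := h₂.eq, hx₂ := by rw [h₂.eq, h₂.eq], hy₂ := by rw [h₂.eq, h₂.eq] }

/-- Auxiliary identity for gluing witnesses. [folklore] -/
theorem g_tautological (hQ : IsIdempotentElem Q) :
    (tautological hQ : GluingWitness Q _ _).g = (Q.map (resHom X₁)).map (ovl₁ X₁ X₂) := by
  change (Q.map (resHom X₂)).map (ovl₂ X₁ X₂) * (Q.map (resHom X₁)).map (ovl₁ X₁ X₂) = _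
  rw [← map_resHom_ovl, ← Matrix.map_mul, ← Matrix.map_mul, hQ.eq]

end GluingWitness

/-! ### Existence: the clutching construction with its witness -/

section Existence

variable [NormalSpace Y]

/-- **Clutching with prescribed transition** (the construction of `exists_idempotent_of_clutching`
together with its gluing witness): for idempotents `P₁`, `P₂` of the same size over the closed
pieces of a normal space, conjugate over the overlap by an invertible `u` (`u P₁ v = P₂`,
`u v = v u = 1`), there is a glued idempotent `Q` with local models `P₁`, `P₂` and transition
function `g = P₂|_A u P₁|_A`. [cite: HusemollerEtAl2008, Ch. 3 §7 (7.2)] -/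
theorem exists_gluingWitness (h₁ : IsClosed X₁) (h₂ : IsClosed X₂) (hcov : X₁ ∪ X₂ = univ)
    {n : Type*} [Fintype n] [DecidableEq n]
    {P₁ : Matrix n n C(X₁, ℂ)} {P₂ : Matrix n n C(X₂, ℂ)} (hP₁ : IsIdempotentElem P₁) (hP₂ : IsIdempotentElem P₂)
    (u v : Matrix n n C(↥(X₁ ∩ X₂), ℂ)) (huv : u * v = 1) (hvu : v * u = 1)
    (hconj : u * P₁.map (ovl₁ X₁ X₂) * v = P₂.map (ovl₂ X₁ X₂)) :
    ∃ (Q : Matrix (n ⊕ n) (n ⊕ n) C(Y, ℂ)) (w : GluingWitness Q P₁ P₂),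
      w.g = P₂.map (ovl₂ X₁ X₂) * u * P₁.map (ovl₁ X₁ X₂) := by
  have hA : IsClosed (X₁ ∩ X₂) := h₁.inter h₂
  obtain ⟨a, ha⟩ := matrix_map_resHom_surjective hA u
  obtain ⟨b, hb⟩ := matrix_map_resHom_surjective hA (-v)
  have ha₂ : (a.map (resHom X₂)).map (ovl₂ X₁ X₂) = u := by rw [Matrix.map_map, ← ha]; rfl
  have hb₂ : (b.map (resHom X₂)).map (ovl₂ X₁ X₂) = -v := by rw [Matrix.map_map, ← hb]; rfl
  obtain ⟨L, L', hLL', hL'L, hLf⟩ := exists_lift_fromBlocks (ovl₂ X₁ X₂) huv hvu ha₂ hb₂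
  set Q₁ : Matrix (n ⊕ n) (n ⊕ n) C(X₁, ℂ) := Matrix.fromBlocks P₁ 0 0 0
  set B₂ : Matrix (n ⊕ n) (n ⊕ n) C(X₂, ℂ) := Matrix.fromBlocks P₂ 0 0 0
  set Q₂ : Matrix (n ⊕ n) (n ⊕ n) C(X₂, ℂ) := L' * B₂ * L
  have hL'f : L'.map (ovl₂ X₁ X₂) * Matrix.fromBlocks u 0 0 v = 1 := by
    rw [← hLf, ← Matrix.map_mul, hL'L, Matrix.map_one _ (map_zero _) (map_one _)]
  have hagree : Q₁.map (ovl₁ X₁ X₂) = Q₂.map (ovl₂ X₁ X₂) := by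
    have e1 : Q₁.map (ovl₁ X₁ X₂) = Matrix.fromBlocks (P₁.map (ovl₁ X₁ X₂)) 0 0 0 := by
      simp only [Q₁, Matrix.fromBlocks_map, Matrix.map_zero _ (map_zero _)]
    have e2 : B₂.map (ovl₂ X₁ X₂) =
        Matrix.fromBlocks u 0 0 v * Matrix.fromBlocks (P₁.map (ovl₁ X₁ X₂)) 0 0 0 * Matrix.fromBlocks v 0 0 u := by
      rw [show B₂.map (ovl₂ X₁ X₂) = Matrix.fromBlocks (P₂.map (ovl₂ X₁ X₂)) 0 0 0 by
        simp only [B₂, Matrix.fromBlocks_map, Matrix.map_zero _ (map_zero _)], ← hconj]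
      simp [Matrix.fromBlocks_multiply]
    rw [e1, show Q₂ = L' * B₂ * L from rfl, Matrix.map_mul, Matrix.map_mul, e2, hLf]
    calc Matrix.fromBlocks (P₁.map (ovl₁ X₁ X₂)) 0 0 0
        = (L'.map (ovl₂ X₁ X₂) * Matrix.fromBlocks u 0 0 v) * Matrix.fromBlocks (P₁.map (ovl₁ X₁ X₂)) 0 0 0 *
            (Matrix.fromBlocks v 0 0 u * Matrix.fromBlocks u 0 0 v) := by
          rw [hL'f, fromBlocks_diag_mul_fromBlocks_diag u v huv hvu, Matrix.one_mul, Matrix.mul_one]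
      _ = _ := by simp only [Matrix.mul_assoc]
  obtain ⟨Q, hQr₁, hQr₂⟩ := exists_matrix_of_restrict_eq h₁ h₂ hcov Q₁ Q₂ hagree
  -- the witness matrices
  set R₁ : Matrix (n ⊕ n) n C(X₁, ℂ) := Matrix.fromRows P₁ (0 : Matrix n n C(X₁, ℂ))
  set C₁ : Matrix n (n ⊕ n) C(X₁, ℂ) := Matrix.fromCols P₁ (0 : Matrix n n C(X₁, ℂ))
  set R₂ : Matrix (n ⊕ n) n C(X₂, ℂ) := Matrix.fromRows P₂ (0 : Matrix n n C(X₂, ℂ))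
  set C₂ : Matrix n (n ⊕ n) C(X₂, ℂ) := Matrix.fromCols P₂ (0 : Matrix n n C(X₂, ℂ))
  have hRC₁ : R₁ * C₁ = Q₁ := by rw [Matrix.fromRows_mul_fromCols, hP₁.eq]; simp [Q₁]
  have hCR₁ : C₁ * R₁ = P₁ := by rw [Matrix.fromCols_mul_fromRows, hP₁.eq]; simp
  have hQR₁ : Q₁ * R₁ = R₁ := by rw [Matrix.fromBlocks_mul_fromRows, hP₁.eq]; simp [R₁]
  have hCQ₁ : C₁ * Q₁ = C₁ := by rw [Matrix.fromCols_mul_fromBlocks, hP₁.eq]; simp [C₁]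
  have hRC₂ : R₂ * C₂ = B₂ := by rw [Matrix.fromRows_mul_fromCols, hP₂.eq]; simp [B₂]
  have hCR₂ : C₂ * R₂ = P₂ := by rw [Matrix.fromCols_mul_fromRows, hP₂.eq]; simp
  have hBR₂ : B₂ * R₂ = R₂ := by rw [Matrix.fromBlocks_mul_fromRows, hP₂.eq]; simp [R₂]
  have hCB₂ : C₂ * B₂ = C₂ := by rw [Matrix.fromCols_mul_fromBlocks, hP₂.eq]; simp [C₂]
  refine ⟨Q,
    { x₁ := R₁, y₁ := C₁, x₂ := L' * R₂, y₂ := C₂ * L,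
      hxy₁ := by rw [hQr₁, hRC₁], hyx₁ := hCR₁,
      hx₁ := by rw [hRC₁, hQR₁], hy₁ := by rw [hCR₁, ← hCR₁, Matrix.mul_assoc, hRC₁, hCQ₁]
      hxy₂ := ?_, hyx₂ := ?_, hx₂ := ?_, hy₂ := ?_ }, ?_⟩
  · rw [hQr₂]
    calc L' * R₂ * (C₂ * L) = L' * (R₂ * C₂) * L := by simp only [Matrix.mul_assoc]
      _ = Q₂ := by rw [hRC₂]
  · calc C₂ * L * (L' * R₂) = C₂ * (L * L') * R₂ := by simp only [Matrix.mul_assoc]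
      _ = P₂ := by rw [hLL', Matrix.mul_one, hCR₂]
  · calc L' * R₂ * (C₂ * L) * (L' * R₂) = L' * (R₂ * C₂) * (L * L') * R₂ := by simp only [Matrix.mul_assoc]
      _ = L' * R₂ := by rw [hLL', Matrix.mul_one, hRC₂, Matrix.mul_assoc, hBR₂]
  · calc C₂ * L * (L' * R₂) * (C₂ * L) = C₂ * (L * L') * (R₂ * C₂) * L := by simp only [Matrix.mul_assoc]
      _ = C₂ * L := by rw [hLL', Matrix.mul_one, hRC₂, hCB₂]
  · -- the transition function
    change (C₂ * L).map (ovl₂ X₁ X₂) * R₁.map (ovl₁ X₁ X₂) = _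
    rw [Matrix.map_mul, hLf]
    simp only [C₂, R₁, Matrix.fromCols_map, Matrix.fromRows_map, Matrix.map_zero _ (map_zero _)]
    rw [Matrix.fromCols_mul_fromBlocks, Matrix.fromCols_mul_fromRows]
    simp [Matrix.mul_assoc]

end Existence

end Literature.AlgebraicTopology.KTheory

end
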